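import Literature.MathematicalPhysics.QuantumChemistry.SecondQuantizedHamiltonian
import Literature.MathematicalPhysics.QuantumChemistry.PositivityConditions
import HarnessLib

/-!
# The electronic energy is a linear functional of the one- and two-particle reduced density matrices

Topic `Literature/MathematicalPhysics/QuantumChemistry`; joins `SecondQuantizedHamiltonian.lean` (the
spin-free molecular Hamiltonian `Ĥ = Σ h_pq E_pq + ½ Σ g_pqrs e_pqrs + h_nuc·1`, Helgaker–Jørgensen–
Olsen eq. (2.2.18)) to `PositivityConditions.lean` (the reduced density matrices `¹D`, `²D` of a
Fock-space vector): for every vector `ψ`,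

  `⟨ψ| Ĥ |ψ⟩ = Σ_pq h_pq Σ_σ ¹D^{pσ}_{qσ} + ½ Σ_pqrs g_pqrs Σ_στ ²D^{pσ,rτ}_{qσ,sτ} + h_nuc ⟨ψ|ψ⟩`

(`expect_molecularHamiltonian_eq_rdm`) — Mazziotti (2007) eqs. (1)–(7) (`E = Tr(¹K ¹D) + Tr(²K ²D)`,
the starting point of the variational 2-RDM method: the energy functional that is MINIMISED over the
positivity conditions of `PositivityConditions.lean`), equivalently Helgaker–Jørgensen–Olsen's
density-matrix form of the energy expectation value. Everything is PROVED (0 sorry); no definitions,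
no named facts.

## References
* D. A. Mazziotti, *Variational two-electron reduced-density-matrix theory*, in: Reduced-Density-Matrix
  Mechanics, Adv. Chem. Phys. 134 (Wiley, 2007) 21–59, §II.A eqs. (1)–(7).
  [cite: Mazziotti2007RDMChapter, §II.A eqs. (1)-(7)]
* T. Helgaker, P. Jørgensen, J. Olsen, *Molecular Electronic-Structure Theory* (Wiley, 2000),
  eq. (2.2.18) and §2.7 (density matrices). [cite: HelgakerJorgensenOlsen2000, eq. (2.2.18)]
-/

noncomputable section

namespace Literature.MathematicalPhysics.QuantumChemistry

open Matrix Finset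
open Literature.MathematicalPhysics.QuantumLattice
open scoped ComplexOrder BigOperators

variable {Λ : Type*} [LinearOrder Λ] [Fintype Λ]

/-- The one-electron part: `⟨ψ| E_pq |ψ⟩ = Σ_σ ¹D^{pσ}_{qσ}`. Mazziotti (2007) eq. (7) (one-particle
analogue); Helgaker–Jørgensen–Olsen eq. (2.2.7). [cite: Mazziotti2007RDMChapter, §II.A eqs. (6)-(7)] -/
theorem expect_singletExcitation_eq_oneRDM (p q : Λ) (ψ : Fock (Orb Λ)) :
    star ψ ⬝ᵥ singletExcitation p q *ᵥ ψ = ∑ σ : Fin 2, oneRDM ψ (orb p σ) (orb q σ) := by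
  simp only [singletExcitation, oneRDM, Matrix.sum_mulVec, dotProduct_sum]

/-- The two-electron part: `⟨ψ| e_pqrs |ψ⟩ = Σ_στ ²D^{(pσ)(rτ)}_{(qσ)(sτ)}` — the summand
`a†_{pσ} a†_{rτ} a_{sτ} a_{qσ}` of `e_pqrs` IS the operator whose expectation is the 2-RDM element
with upper indices `(pσ, rτ)` and lower indices `(qσ, sτ)`. Mazziotti (2007) eq. (7).
[cite: Mazziotti2007RDMChapter, §II.A eq. (7)] -/
theorem expect_twoElectronExcitation_eq_twoRDM (p q r s : Λ) (ψ : Fock (Orb Λ)) :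
    star ψ ⬝ᵥ twoElectronExcitation p q r s *ᵥ ψ =
      ∑ σ : Fin 2, ∑ τ : Fin 2, twoRDM ψ (orb p σ, orb r τ) (orb q σ, orb s τ) := by
  simp only [twoElectronExcitation, twoRDM, Matrix.sum_mulVec, dotProduct_sum]

/-- **The energy is a linear functional of the 1- and 2-RDM**: for every Fock-space vector `ψ`,
`⟨ψ|Ĥ|ψ⟩ = Σ_pq h_pq Σ_σ ¹D^{pσ}_{qσ} + ½ Σ_pqrs g_pqrs Σ_στ ²D^{pσ,rτ}_{qσ,sτ} + h_nuc ⟨ψ|ψ⟩`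
(Mazziotti's `E = Tr(¹K ¹D) + Tr(²K ²D)` with the reduced Hamiltonian read off from the integral
tables; no normalisation or particle-number assumption on `ψ`). Mazziotti (2007) eqs. (1)–(7).
[cite: Mazziotti2007RDMChapter, §II.A eqs. (1)-(7)] -/
theorem expect_molecularHamiltonian_eq_rdm (h : Λ → Λ → ℂ) (g : Λ → Λ → Λ → Λ → ℂ) (hnuc : ℂ)
    (ψ : Fock (Orb Λ)) :
    star ψ ⬝ᵥ molecularHamiltonian h g hnuc *ᵥ ψ =
      ∑ p : Λ, ∑ q : Λ, h p q * ∑ σ : Fin 2, oneRDM ψ (orb p σ) (orb q σ) +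
        (1 / 2 : ℂ) * ∑ p : Λ, ∑ q : Λ, ∑ r : Λ, ∑ s : Λ,
          g p q r s * ∑ σ : Fin 2, ∑ τ : Fin 2, twoRDM ψ (orb p σ, orb r τ) (orb q σ, orb s τ) +
        hnuc * (star ψ ⬝ᵥ ψ) := by
  simp only [molecularHamiltonian, add_mulVec, smul_mulVec, Matrix.sum_mulVec, one_mulVec,
    dotProduct_add, dotProduct_smul, dotProduct_sum, smul_eq_mul, Finset.mul_sum,
    expect_singletExcitation_eq_oneRDM, expect_twoElectronExcitation_eq_twoRDM]

end Literature.MathematicalPhysics.QuantumChemistry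

end
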